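import Mathlib.LinearAlgebra.Dual.Lemmas
import Mathlib.Algebra.Module.Projective
import Mathlib.LinearAlgebra.Prod
import Mathlib.RingTheory.Ideal.Maps
import HarnessLib

/-!
# `Ext¹` by projective presentations: functoriality and independence of the presentation

Topic: `Literature/AlgebraicGeometry/Resolution` (infrastructure making the `Ext`-annihilator ideals
of `SyzygyStaircase.lean` / `ExtAnnihilatorAffineGlobal.lean` independent of the chosen free
resolution).

For a presentation `0 → K →(ι) P →(π) N → 0` (`ι` injective, `im ι = ker π`, `π` surjective) put
`E(ι) = K^* / im(ι^* : P^* → K^*)` (`PresExt.E ι`; for `P` projective this is `Ext¹_R(N, R)`, and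
the modules `E^{q+1}` of `SyzygyStaircase.lean` are literally `E(j_q)` for the syzygy
presentations `0 → K_{q+1} → F_q → K_q → 0`). We prove the classical facts:

* `PresExt.map` — a pair of compatible maps `g̃ : P → P'`, `g_K : K → K'` over `g : N → N'`
  induces `E(ι') → E(ι)`; `PresExt.map_eq_map` — **independence of the lift** (two lifts of the
  same `g` differ by a map `P → K'`, which dies in `E`); `map_id`, `map_comp`;
* `PresExt.exists_lift` — lifts exist when `P` is projective;
* `PresExt.annihilator_eq_of_linearEquiv` — **independence of the presentation**: presentations
  of isomorphic modules by projectives have `E`'s with the same annihilator (indeed isomorphic);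
* `PresExt.range_dualMap_inl_comp`, `PresExt.annihilator_eq_prod_free` — adding a direct summand
  `G` to `P` and `N` (`0 → K → P × G → N × G → 0`) does not change `E`.

[cite: Matsumura1987, §19 Lemma 3 (Schanuel); Appendix B, p. 282 ("Ext … does not depend on
the choice of P")]
-/

noncomputable section

open Module

universe u

namespace Literature.AlgebraicGeometry.Resolution

namespace PresExt

variable {R : Type u} [CommRing R]
variable {K P N K' P' N' K'' P'' N'' : Type u}
  [AddCommGroup K] [Module R K] [AddCommGroup P] [Module R P] [AddCommGroup N] [Module R N]
  [AddCommGroup K'] [Module R K'] [AddCommGroup P'] [Module R P'] [AddCommGroup N'] [Module R N']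
  [AddCommGroup K''] [Module R K''] [AddCommGroup P''] [Module R P'']
  [AddCommGroup N''] [Module R N'']

/-- `E(ι) = K^* / im(ι^*)` for `ι : K → P` (the kernel inclusion of a presentation). [folklore] -/
abbrev E (ι : K →ₗ[R] P) : Type u := Dual R K ⧸ LinearMap.range ι.dualMap

/-- `ψ ∘ g_K` for `ψ ∈ K'^*`: the map `K'^* → K^*` induced by `g_K : K → K'`, descended to
`E(ι') → E(ι)` when `g_K` is the restriction of some `g̃ : P → P'` (`ι' ∘ g_K = g̃ ∘ ι`).
[folklore] -/
def map (ι : K →ₗ[R] P) (ι' : K' →ₗ[R] P') (gt : P →ₗ[R] P') (gK : K →ₗ[R] K')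
    (hcomm : ι' ∘ₗ gK = gt ∘ₗ ι) : E ι' →ₗ[R] E ι :=
  Submodule.mapQ _ _ gK.dualMap (by
    rintro _ ⟨φ', rfl⟩
    refine ⟨gt.dualMap φ', ?_⟩
    ext k
    simp only [LinearMap.dualMap_apply]
    exact congrArg φ' (LinearMap.congr_fun hcomm k).symm)

/-- `map` on representatives: `[ψ'] ↦ [ψ' ∘ g_K]`. [folklore] -/
@[simp] theorem map_mk (ι : K →ₗ[R] P) (ι' : K' →ₗ[R] P') (gt : P →ₗ[R] P') (gK : K →ₗ[R] K')
    (hcomm : ι' ∘ₗ gK = gt ∘ₗ ι) (ψ' : Dual R K') :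
    map ι ι' gt gK hcomm (Submodule.Quotient.mk ψ') = Submodule.Quotient.mk (ψ' ∘ₗ gK) := rfl

/-- **Independence of the lift.** If `(g̃₁, g_{K,1})` and `(g̃₂, g_{K,2})` both lie over the same
`g : N → N'` (`π' ∘ g̃ᵢ = g ∘ π`), `ι'` is injective with image `ker π'`, then the induced maps
`E(ι') → E(ι)` agree: `g̃₁ - g̃₂` factors through `ι'`, so `g_{K,1} - g_{K,2} = h ∘ ι` dies in `E(ι)`.
[folklore] -/
theorem map_eq_map (ι : K →ₗ[R] P) (π : P →ₗ[R] N) (ι' : K' →ₗ[R] P') (π' : P' →ₗ[R] N')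
    (hι' : Function.Injective ι') (hex' : LinearMap.range ι' = LinearMap.ker π')
    (g : N →ₗ[R] N')
    (gt₁ : P →ₗ[R] P') (gK₁ : K →ₗ[R] K') (hcomm₁ : ι' ∘ₗ gK₁ = gt₁ ∘ₗ ι)
    (hover₁ : π' ∘ₗ gt₁ = g ∘ₗ π)
    (gt₂ : P →ₗ[R] P') (gK₂ : K →ₗ[R] K') (hcomm₂ : ι' ∘ₗ gK₂ = gt₂ ∘ₗ ι)
    (hover₂ : π' ∘ₗ gt₂ = g ∘ₗ π) :
    map ι ι' gt₁ gK₁ hcomm₁ = map ι ι' gt₂ gK₂ hcomm₂ := by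
  -- `d = g̃₁ - g̃₂` lands in `ker π' = im ι'`; `h = ι'⁻¹ ∘ d : P → K'`
  have hd : ∀ p, (gt₁ - gt₂) p ∈ LinearMap.range ι' := fun p => by
    rw [hex', LinearMap.mem_ker, LinearMap.sub_apply, map_sub]
    have h1 := LinearMap.congr_fun hover₁ p
    have h2 := LinearMap.congr_fun hover₂ p
    simp only [LinearMap.coe_comp, Function.comp_apply] at h1 h2
    rw [h1, h2, sub_self]
  let h : P →ₗ[R] K' :=
    (LinearEquiv.ofInjective ι' hι').symm.toLinearMap ∘ₗ (gt₁ - gt₂).codRestrict _ hd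
  have hh : ∀ p, ι' (h p) = (gt₁ - gt₂) p := fun p =>
    LinearEquiv.ofInjective_symm_apply (f := ι') (h := hι') ⟨(gt₁ - gt₂) p, hd p⟩
  -- `g_{K,1} - g_{K,2} = h ∘ ι`
  have hK : ∀ k, gK₁ k - gK₂ k = h (ι k) := fun k => hι' (by
    rw [map_sub, hh, LinearMap.sub_apply]
    have e1 := LinearMap.congr_fun hcomm₁ k
    have e2 := LinearMap.congr_fun hcomm₂ k
    simp only [LinearMap.coe_comp, Function.comp_apply] at e1 e2
    rw [e1, e2])
  -- compare on generators of the quotient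
  refine LinearMap.ext fun x => ?_
  induction x using Submodule.Quotient.induction_on with
  | H ψ' =>
    rw [map_mk, map_mk, Submodule.Quotient.eq]
    refine ⟨h.dualMap ψ', ?_⟩
    ext k
    simp only [LinearMap.dualMap_apply, LinearMap.sub_apply, LinearMap.coe_comp,
      Function.comp_apply, ← hK, map_sub]

/-- The identity lift induces the identity. [folklore] -/
theorem map_id (ι : K →ₗ[R] P) :
    map ι ι LinearMap.id LinearMap.id (by rw [LinearMap.comp_id, LinearMap.id_comp]) =
      LinearMap.id := by
  refine LinearMap.ext fun x => ?_
  induction x using Submodule.Quotient.induction_on with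
  | H ψ => rw [map_mk]; rfl

/-- Composition of lifts induces the composition (contravariantly). [folklore] -/
theorem map_comp (ι : K →ₗ[R] P) (ι' : K' →ₗ[R] P') (ι'' : K'' →ₗ[R] P'')
    (gt : P →ₗ[R] P') (gK : K →ₗ[R] K') (hcomm : ι' ∘ₗ gK = gt ∘ₗ ι)
    (gt' : P' →ₗ[R] P'') (gK' : K' →ₗ[R] K'') (hcomm' : ι'' ∘ₗ gK' = gt' ∘ₗ ι') :
    map ι ι'' (gt' ∘ₗ gt) (gK' ∘ₗ gK)
        (by rw [← LinearMap.comp_assoc, hcomm', LinearMap.comp_assoc, hcomm,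
          LinearMap.comp_assoc]) =
      map ι ι' gt gK hcomm ∘ₗ map ι' ι'' gt' gK' hcomm' := by
  refine LinearMap.ext fun x => ?_
  induction x using Submodule.Quotient.induction_on with
  | H ψ => rfl

/-- **Lifts exist over projectives**: for `g : N → N'`, a projective `P` with `π : P → N`, and
a presentation `0 → K' →(ι') P' →(π') N' → 0`, there are `g̃ : P → P'` over `g` and its
restriction `g_K : K → K'` (`K = ker π` via `ι`). [folklore] -/
theorem exists_lift [Module.Projective R P] (ι : K →ₗ[R] P) (π : P →ₗ[R] N)
    (hex : LinearMap.range ι ≤ LinearMap.ker π)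
    (ι' : K' →ₗ[R] P') (π' : P' →ₗ[R] N') (hι' : Function.Injective ι')
    (hex' : LinearMap.range ι' = LinearMap.ker π') (hπ' : Function.Surjective π')
    (g : N →ₗ[R] N') :
    ∃ (gt : P →ₗ[R] P') (gK : K →ₗ[R] K'), ι' ∘ₗ gK = gt ∘ₗ ι ∧ π' ∘ₗ gt = g ∘ₗ π := by
  obtain ⟨gt, hgt⟩ := Module.projective_lifting_property π' (g ∘ₗ π) hπ'
  have hmem : ∀ k, gt (ι k) ∈ LinearMap.range ι' := fun k => by
    rw [hex', LinearMap.mem_ker, ← LinearMap.comp_apply, hgt, LinearMap.comp_apply]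
    have hk : π (ι k) = 0 := LinearMap.mem_ker.mp (hex ⟨k, rfl⟩)
    rw [hk, map_zero]
  refine ⟨gt, (LinearEquiv.ofInjective ι' hι').symm.toLinearMap ∘ₗ (gt ∘ₗ ι).codRestrict _ hmem,
    ?_, hgt⟩
  ext k
  simp only [LinearMap.coe_comp, Function.comp_apply, LinearEquiv.coe_coe]
  exact LinearEquiv.ofInjective_symm_apply (f := ι') (h := hι') ⟨gt (ι k), hmem k⟩

/-- If `u ∘ v = id` on `E` then `Ann E' ⊆ Ann E` for `v : E → E'`, `u : E' → E`. [folklore] -/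
theorem annihilator_le_of_retraction {E₁ E₂ : Type u} [AddCommGroup E₁] [Module R E₁]
    [AddCommGroup E₂] [Module R E₂] (v : E₁ →ₗ[R] E₂) (u : E₂ →ₗ[R] E₁)
    (huv : ∀ x, u (v x) = x) : Module.annihilator R E₂ ≤ Module.annihilator R E₁ := by
  intro a ha
  rw [Module.mem_annihilator] at ha ⊢
  intro x
  rw [← huv x, ← map_smul, ha, map_zero]

/-- **Independence of the presentation.** Two presentations `0 → K → P → N → 0`,
`0 → K' → P' → N' → 0` by projectives `P`, `P'` of isomorphic modules `N ≃ N'` have `E`'s with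
the same annihilator (`E(ι) ≅ E(ι') ≅ Ext¹(N, R)`). [folklore] -/
theorem annihilator_eq_of_linearEquiv [Module.Projective R P] [Module.Projective R P']
    (ι : K →ₗ[R] P) (π : P →ₗ[R] N) (hι : Function.Injective ι)
    (hex : LinearMap.range ι = LinearMap.ker π) (hπ : Function.Surjective π)
    (ι' : K' →ₗ[R] P') (π' : P' →ₗ[R] N') (hι' : Function.Injective ι')
    (hex' : LinearMap.range ι' = LinearMap.ker π') (hπ' : Function.Surjective π')
    (e : N ≃ₗ[R] N') :
    Module.annihilator R (E ι) = Module.annihilator R (E ι') := by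
  obtain ⟨gt, gK, hc, ho⟩ := exists_lift ι π hex.le ι' π' hι' hex' hπ' e.toLinearMap
  obtain ⟨gt', gK', hc', ho'⟩ := exists_lift ι' π' hex'.le ι π hι hex hπ e.symm.toLinearMap
  -- `u : E(ι') → E(ι)`, `v : E(ι) → E(ι')`, both composites are the identity
  have huv : map ι ι' gt gK hc ∘ₗ map ι' ι gt' gK' hc' = LinearMap.id := by
    rw [← map_comp, ← map_id ι]
    refine map_eq_map ι π ι π hι hex LinearMap.id _ _ _ ?_ _ _ _ ?_
    · rw [← LinearMap.comp_assoc, ho', LinearMap.comp_assoc, ho]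
      ext p
      simp
    · rw [LinearMap.comp_id, LinearMap.id_comp]
  have hvu : map ι' ι gt' gK' hc' ∘ₗ map ι ι' gt gK hc = LinearMap.id := by
    rw [← map_comp, ← map_id ι']
    refine map_eq_map ι' π' ι' π' hι' hex' LinearMap.id _ _ _ ?_ _ _ _ ?_
    · rw [← LinearMap.comp_assoc, ho, LinearMap.comp_assoc, ho']
      ext p
      simp
    · rw [LinearMap.comp_id, LinearMap.id_comp]
  exact le_antisymm
    (annihilator_le_of_retraction (map ι ι' gt gK hc) (map ι' ι gt' gK' hc')
      (fun x => LinearMap.congr_fun hvu x))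
    (annihilator_le_of_retraction (map ι' ι gt' gK' hc') (map ι ι' gt gK hc)
      (fun x => LinearMap.congr_fun huv x))

/-! ## Adding a free (or any) direct summand -/

/-- For `ι₂ = inl ∘ ι : K → P × G`, `im(ι₂^*) = im(ι^*)` in `K^*`. [folklore] -/
theorem range_dualMap_inl_comp {G : Type u} [AddCommGroup G] [Module R G] (ι : K →ₗ[R] P) :
    LinearMap.range ((LinearMap.inl R P G) ∘ₗ ι).dualMap = LinearMap.range ι.dualMap := by
  apply le_antisymm
  · rintro _ ⟨φ, rfl⟩
    exact ⟨φ ∘ₗ LinearMap.inl R P G, by ext k; rfl⟩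
  · rintro _ ⟨φ₀, rfl⟩
    exact ⟨φ₀ ∘ₗ LinearMap.fst R P G, by ext k; rfl⟩

/-- `E(inl ∘ ι) = E(ι)` have the same annihilator (they are the same quotient of `K^*`).
[folklore] -/
theorem annihilator_E_inl_comp {G : Type u} [AddCommGroup G] [Module R G] (ι : K →ₗ[R] P) :
    Module.annihilator R (E ((LinearMap.inl R P G) ∘ₗ ι)) = Module.annihilator R (E ι) := by
  have e : E ((LinearMap.inl R P G) ∘ₗ ι) ≃ₗ[R] E ι :=
    Submodule.quotEquivOfEq _ _ (range_dualMap_inl_comp ι)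
  exact e.annihilator_eq

/-- The presentation `0 → K →(inl ∘ ι) P × G →(π × id) N × G → 0` obtained by adding a direct
summand: exactness data. [folklore] -/
theorem presentation_prod {G : Type u} [AddCommGroup G] [Module R G] (ι : K →ₗ[R] P)
    (π : P →ₗ[R] N) (hι : Function.Injective ι) (hex : LinearMap.range ι = LinearMap.ker π)
    (hπ : Function.Surjective π) :
    Function.Injective ((LinearMap.inl R P G) ∘ₗ ι) ∧
      LinearMap.range ((LinearMap.inl R P G) ∘ₗ ι) = LinearMap.ker (π.prodMap LinearMap.id) ∧
        Function.Surjective (π.prodMap (LinearMap.id : G →ₗ[R] G)) := by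
  refine ⟨fun a b h => hι (by simpa using h), ?_, fun ⟨n, g⟩ => ?_⟩
  · ext ⟨p, g⟩
    simp only [LinearMap.mem_range, LinearMap.coe_comp, Function.comp_apply, LinearMap.inl_apply,
      Prod.mk.injEq, LinearMap.mem_ker, LinearMap.prodMap_apply, LinearMap.id_apply,
      Prod.mk_eq_zero]
    constructor
    · rintro ⟨k, hk, rfl⟩
      refine ⟨?_, rfl⟩
      rw [← hk]
      exact LinearMap.mem_ker.mp (hex.le ⟨k, rfl⟩)
    · rintro ⟨hp, rfl⟩
      obtain ⟨k, hk⟩ := (hex.ge (LinearMap.mem_ker.mpr hp) : p ∈ LinearMap.range ι)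
      exact ⟨k, hk, rfl⟩
  · obtain ⟨p, rfl⟩ := hπ n
    exact ⟨(p, g), rfl⟩

/-! ## Schanuel's lemma -/

section Schanuel

variable {W : Type u} [AddCommGroup W] [Module R W]

/-- The fibre product `P ×_W P' = ker (α ∘ pr₁ - β ∘ pr₂)` of `α : P → W`, `β : P' → W`.
[folklore] -/
abbrev fibreProd (α : P →ₗ[R] W) (β : P' →ₗ[R] W) : Submodule R (P × P') :=
  LinearMap.ker (α ∘ₗ LinearMap.fst R P P' - β ∘ₗ LinearMap.snd R P P')

omit [AddCommGroup K] [Module R K] [AddCommGroup K'] [Module R K'] in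
/-- Membership in the fibre product: `α x₁ = β x₂`. [folklore] -/
theorem mem_fibreProd_iff (α : P →ₗ[R] W) (β : P' →ₗ[R] W) (x : P × P') :
    x ∈ fibreProd α β ↔ α x.1 = β x.2 := by
  simp [fibreProd, sub_eq_zero]

omit [AddCommGroup K] [Module R K] in
/-- **Half of Schanuel's lemma**: if `P` is projective and `β : P' → W` is surjective with kernel
`im ι'` (`ι'` injective), then `P ×_W P' ≃ P × K'`: the projection to `P` is surjective with
kernel `K'`, and splits. [cite: Matsumura1987, §19 Lemma 3 (Schanuel), proof] -/
theorem nonempty_fibreProd_equiv_prod [Module.Projective R P] (α : P →ₗ[R] W)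
    (ι' : K' →ₗ[R] P') (β : P' →ₗ[R] W)
    (hι' : Function.Injective ι') (hex' : LinearMap.range ι' = LinearMap.ker β)
    (hβ : Function.Surjective β) :
    Nonempty (fibreProd α β ≃ₗ[R] (P × K')) := by
  -- the projection `p₁ : X → P` is surjective; choose a splitting `s`
  let p₁ : fibreProd α β →ₗ[R] P := LinearMap.fst R P P' ∘ₗ (fibreProd α β).subtype
  have hp₁ : Function.Surjective p₁ := fun p => by
    obtain ⟨p', hp'⟩ := hβ (α p)
    exact ⟨⟨(p, p'), (mem_fibreProd_iff α β _).mpr hp'.symm⟩, rfl⟩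
  obtain ⟨s, hs⟩ := Module.projective_lifting_property p₁ LinearMap.id hp₁
  have hs' : ∀ p, ((s p : fibreProd α β) : P × P').1 = p := fun p => LinearMap.congr_fun hs p
  -- `t x = x - s (p₁ x)` has first coordinate `0`, so its second coordinate lies in `ker β = im ι'`
  let t : fibreProd α β →ₗ[R] fibreProd α β := LinearMap.id - s ∘ₗ p₁
  have ht_fst : ∀ x, ((t x : fibreProd α β) : P × P').1 = 0 := fun x => by
    change (x : P × P').1 - ((s (x : P × P').1 : fibreProd α β) : P × P').1 = 0
    rw [hs', sub_self]
  have ht_snd_mem : ∀ x, ((t x : fibreProd α β) : P × P').2 ∈ LinearMap.range ι' := fun x => by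
    rw [hex', LinearMap.mem_ker]
    have hmem := (mem_fibreProd_iff α β _).mp (t x).2
    rw [ht_fst, map_zero] at hmem
    exact hmem.symm
  let r : fibreProd α β →ₗ[R] P' := LinearMap.snd R P P' ∘ₗ (fibreProd α β).subtype ∘ₗ t
  let κ : fibreProd α β →ₗ[R] K' :=
    (LinearEquiv.ofInjective ι' hι').symm.toLinearMap ∘ₗ r.codRestrict _ ht_snd_mem
  have hκ : ∀ x, ι' (κ x) = ((t x : fibreProd α β) : P × P').2 := fun x =>
    LinearEquiv.ofInjective_symm_apply (f := ι') (h := hι') ⟨r x, ht_snd_mem x⟩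
  -- the embedding `j : K' → X`, `k' ↦ (0, ι' k')`
  have hj : ∀ k' : K', ((0 : P), ι' k') ∈ fibreProd α β := fun k' => by
    rw [mem_fibreProd_iff, map_zero]
    exact (LinearMap.mem_ker.mp (hex'.le ⟨k', rfl⟩)).symm
  let j : K' →ₗ[R] fibreProd α β :=
    { toFun := fun k' => ⟨(0, ι' k'), hj k'⟩
      map_add' := fun a b => by ext <;> simp
      map_smul' := fun c a => by ext <;> simp }
  have hj_coe : ∀ k', ((j k' : fibreProd α β) : P × P') = (0, ι' k') := fun _ => rfl
  -- `t (s p) = 0`, `t (j k') = j k'`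
  have hts : ∀ p, t (s p) = 0 := fun p => by
    change s p - s ((s p : fibreProd α β) : P × P').1 = 0
    rw [hs', sub_self]
  have htj : ∀ k', t (j k') = j k' := fun k' => by
    change j k' - s ((j k' : fibreProd α β) : P × P').1 = j k'
    rw [hj_coe]
    simp
  refine ⟨LinearEquiv.ofLinear (p₁.prod κ) (s.coprod j) ?_ ?_⟩
  · -- `Φ (Ψ (p, k')) = (p, k')`
    refine LinearMap.ext fun x => Prod.ext ?_ ?_
    · change ((s x.1 + j x.2 : fibreProd α β) : P × P').1 = x.1
      rw [Submodule.coe_add, Prod.fst_add, hs', hj_coe, add_zero]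
    · change κ (s x.1 + j x.2) = x.2
      apply hι'
      rw [hκ, map_add, hts, htj, zero_add, hj_coe]
  · -- `Ψ (Φ x) = s (p₁ x) + j (κ x) = x`
    refine LinearMap.ext fun x => Subtype.ext (Prod.ext ?_ ?_)
    · change ((s (x : P × P').1 + j (κ x) : fibreProd α β) : P × P').1 = (x : P × P').1
      rw [Submodule.coe_add, Prod.fst_add, hs', hj_coe, add_zero]
    · change ((s (x : P × P').1 + j (κ x) : fibreProd α β) : P × P').2 = (x : P × P').2
      rw [Submodule.coe_add, Prod.snd_add, hj_coe, hκ]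
      change ((s (x : P × P').1 : fibreProd α β) : P × P').2 +
        ((x - s ((x : P × P').1) : fibreProd α β) : P × P').2 = (x : P × P').2
      rw [Submodule.coe_sub, Prod.snd_sub, add_sub_cancel]

omit [AddCommGroup K'] [Module R K'] in
/-- The other half: if `P'` is projective and `α : P → W` is surjective with kernel `im ι`, then
`P ×_W P' ≃ K × P'`. [cite: Matsumura1987, §19 Lemma 3 (Schanuel), proof] -/
theorem nonempty_fibreProd_equiv_prod' [Module.Projective R P'] (ι : K →ₗ[R] P) (α : P →ₗ[R] W)
    (β : P' →ₗ[R] W) (hι : Function.Injective ι) (hex : LinearMap.range ι = LinearMap.ker α)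
    (hα : Function.Surjective α) :
    Nonempty (fibreProd α β ≃ₗ[R] (K × P')) := by
  -- reduce to the first half through the swap `P × P' ≃ P' × P`
  obtain ⟨Φ⟩ := nonempty_fibreProd_equiv_prod (K' := K) β ι α hι hex hα
  have hmap : (fibreProd α β).map (LinearEquiv.prodComm R P P').toLinearMap = fibreProd β α := by
    ext x
    simp only [Submodule.mem_map, mem_fibreProd_iff, LinearEquiv.coe_coe, Prod.exists,
      LinearEquiv.prodComm_apply, Prod.swap_prod_mk]
    constructor
    · rintro ⟨a, b, h, rfl⟩
      exact h.symm
    · intro h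
      exact ⟨x.2, x.1, h.symm, rfl⟩
  let σ : fibreProd α β ≃ₗ[R] fibreProd β α :=
    LinearEquiv.ofSubmodules (LinearEquiv.prodComm R P P') _ _ hmap
  exact ⟨σ.trans (Φ.trans (LinearEquiv.prodComm R P' K))⟩

/-- **Schanuel's lemma.** For presentations `0 → K → P → N → 0`, `0 → K' → P' → N' → 0` with
`P`, `P'` projective and `N ≃ N'`: `K × P' ≃ K' × P`.
[cite: Matsumura1987, §19 Lemma 3 (Schanuel)] -/
theorem schanuel [Module.Projective R P] [Module.Projective R P']
    (ι : K →ₗ[R] P) (π : P →ₗ[R] N) (ι' : K' →ₗ[R] P') (π' : P' →ₗ[R] N')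
    (hι : Function.Injective ι) (hex : LinearMap.range ι = LinearMap.ker π)
    (hπ : Function.Surjective π)
    (hι' : Function.Injective ι') (hex' : LinearMap.range ι' = LinearMap.ker π')
    (hπ' : Function.Surjective π') (e : N ≃ₗ[R] N') :
    Nonempty ((K × P') ≃ₗ[R] (K' × P)) := by
  have hexα : LinearMap.range ι = LinearMap.ker (e.toLinearMap ∘ₗ π) := by
    rw [hex]; ext p; simp
  have hα : Function.Surjective (e.toLinearMap ∘ₗ π) := e.surjective.comp hπ
  obtain ⟨Φ⟩ := nonempty_fibreProd_equiv_prod (e.toLinearMap ∘ₗ π) ι' π' hι' hex' hπ'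
  obtain ⟨Φ'⟩ := nonempty_fibreProd_equiv_prod' ι (e.toLinearMap ∘ₗ π) π' hι hexα hα
  exact ⟨Φ'.symm.trans (Φ.trans (LinearEquiv.prodComm R P K'))⟩

end Schanuel

end PresExt

end Literature.AlgebraicGeometry.Resolution

end
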